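import Summits.ABC.ABC.Theorems.TwistAmplificationMazurKaneLawDEProductVars
import Summits.ABC.ABC.Theorems.TwistAmplificationMazurKaneLawDESumRoots
import Summits.ABC.ABC.Theorems.TwistAmplificationMazurKaneLawDEDyadic
import Summits.ABC.ABC.Theorems.TwistAmplificationMazurKaneLawDEShort
import Summits.ABC.ABC.Theorems.TwistAmplificationMazurKaneLawDEExact
import Summits.ABC.ABC.Theorems.TwistAmplificationMazurKaneLawDEInexact

-- Summit.ABC.ABC is the mandated summit-side namespace (single-conjunct summit); the lakefile sets the same option tree-wide.
set_option linter.dupNamespace false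

/-!
# The multiplicative-energy bound of the DE tool (crux stmt-ABC-2757, stub `de_energy_sum_le`)

Assembly step of the "DE tool" for the line `critical-kloosterman-powerful-moduli` of the crux
`Summit.ABC.ABC.Theses.TwistAmplification.MazurKaneLaw`: host box `X` with level set `Q` (host
tuples `r ∈ subBox Qᶜ X`, modulus `q(r) = W_Q(r) = onVal Q r`, `q_min = W_Q(X)`), side boxes
`Y, Z`, `NQ = #subBox Qᶜ X`, `NC = #subBox{i₀,i₁} Y · #subBox{i₀,i₁} Z`, `S = 4 Y_{i₁} Z_{i₁}`,
`τ ≤ Dτ` up to `8T³`.  `Summit.ABC.ABC.Theorems.MazurKaneLaw.de_energy_sum_le` bounds the sum over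
`r` of the mixed multiplicative energies `#R_{q(r)}` by
`100 Dτ^{4d+7} (NQ NC² S²/q_min + NQ NC² + S NQ NC + S NC² √NQ)`.  Chain: `#R_q ≤ Dτ² #G₀(q) ≤
Dτ² Σ_{cd} Σ_{roots l} N(q, l)` (`de_energy_le_productVars`, `de_productVars_card_le_sum_coprime`),
summed over `r` and reindexed by the fibre set `ΦL` of `de_card_fibres_le`
(`de_energy_sum_nat_le`); the dyadic lattice-point bound `de_sum_latticeCount_dyadic_le`; the
level counts `de_card_short_le`, `de_card_exact_le` + `de_card_inexact_le` at the levels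
`4^k ≤ 4T` (at most `Dτ + 1` of them as `T < 2^{Dτ}`) against the trivial bound
`de_card_fibres_le` (a `min`-trick), and the geometric tail `≤ 1/√T` at the large levels
(`de_dyadic_sum_le`); bookkeeping of the constants (`de_energy_assemble`).
No new definitions; everything here is folklore bookkeeping.
-/

namespace Summit.ABC.ABC.Theorems.MazurKaneLaw

open Finset
open Literature.NumberTheory.DiophantineGeometry
open Literature.NumberTheory.DiophantineGeometry.AbcShapes

/-- Reindexing: the triple sum `Σ_r Σ_{c : P₁ ∧ P₂} Σ_{l < q r : P₃} f r l` equals the single sum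
of `f` over the finite set of triples `((r, c), l)`, `l < qmax`, cut out by the same conditions
(`Finset.sum_finset_product'` twice). [folklore] -/
theorem de_sum_sum_sum_eq_sum_fibres {β γ : Type*} (R : Finset β) (C : Finset γ) (q : β → ℕ)
    (qmax : ℕ) (hq : ∀ r ∈ R, q r ≤ qmax) (P₁ P₂ : β → γ → Prop) [∀ r c, Decidable (P₁ r c)]
    [∀ r c, Decidable (P₂ r c)] (P₃ : β → γ → ℕ → Prop) [∀ r c l, Decidable (P₃ r c l)]
    (f : β → ℕ → ℕ) :
    ∑ r ∈ R, ∑ c ∈ C.filter (fun c => P₁ r c ∧ P₂ r c),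
        ∑ l ∈ (Finset.range (q r)).filter (fun l => P₃ r c l), f r l =
      ∑ φ ∈ ((R ×ˢ C) ×ˢ Finset.range qmax).filter (fun φ : (β × γ) × ℕ =>
          φ.2 < q φ.1.1 ∧ P₁ φ.1.1 φ.1.2 ∧ P₂ φ.1.1 φ.1.2 ∧ P₃ φ.1.1 φ.1.2 φ.2), f φ.1.1 φ.2 := by
  rw [← Finset.sum_finset_product'
    ((R ×ˢ C).filter (fun rc : β × γ => P₁ rc.1 rc.2 ∧ P₂ rc.1 rc.2)) R
    (fun r => C.filter (fun c => P₁ r c ∧ P₂ r c))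
    (fun rc => by simp only [mem_filter, mem_product, and_assoc])]
  refine (Finset.sum_finset_product' _ _
    (fun rc : β × γ => (Finset.range (q rc.1)).filter (fun l => P₃ rc.1 rc.2 l)) fun φ => ?_).symm
  simp only [mem_filter, mem_product, mem_range]
  constructor
  · rintro ⟨⟨⟨hr, hc⟩, -⟩, hl, h₁, h₂, h₃⟩
    exact ⟨⟨⟨hr, hc⟩, h₁, h₂⟩, hl, h₃⟩
  · rintro ⟨⟨⟨hr, hc⟩, h₁, h₂⟩, hl, h₃⟩
    exact ⟨⟨⟨hr, hc⟩, hl.trans_le (hq _ hr)⟩, hl, h₁, h₂, h₃⟩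

/-- Splitting a divisibility count `q ∣ D` into its exact part `D = 0` and its inexact part
`D ≠ 0, q ∣ D`. [folklore] -/
theorem de_card_filter_dvd_le_add {α : Type*} (s : Finset α) (P : α → Prop) [DecidablePred P]
    (q D : α → ℤ) :
    (s.filter (fun w => P w ∧ q w ∣ D w)).card ≤
      (s.filter (fun w => P w ∧ D w = 0)).card +
        (s.filter (fun w => P w ∧ D w ≠ 0 ∧ q w ∣ D w)).card := by
  classical
  refine (card_le_card fun w hw => ?_).trans (card_union_le _ _)
  rw [mem_union, mem_filter, mem_filter]; rw [mem_filter] at hw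
  by_cases h : D w = 0
  · exact Or.inl ⟨hw.1, hw.2.1, h⟩
  · exact Or.inr ⟨hw.1, hw.2.1, h, hw.2.2⟩

/-- The large dyadic levels `4^k > 4T`, `k < T + 2`, have `Σ 2^{-k} ≤ 1/√T`: they lie above
`k* = log₄(4T) + 1`, the geometric tail is `≤ 2 · 2^{-k*}`, and `2^{k*} > 2√T`. [folklore] -/
theorem de_sum_inv_two_pow_high_le (T : ℕ) (hT : 0 < T) :
    ∑ k ∈ (Finset.range (T + 2)).filter (fun k => ¬4 ^ k ≤ 4 * T), 1 / (2 : ℝ) ^ k ≤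
      1 / Real.sqrt (T : ℝ) := by
  have h4T : 4 * T < 4 ^ (Nat.log 4 (4 * T) + 1) := Nat.lt_pow_succ_log_self (by norm_num) _
  have hsub : (Finset.range (T + 2)).filter (fun k => ¬4 ^ k ≤ 4 * T) ⊆
      Finset.Ico (Nat.log 4 (4 * T) + 1) (T + 2) := by
    intro k hk
    rw [mem_filter, mem_range] at hk
    refine mem_Ico.mpr ⟨?_, hk.1⟩
    by_contra hcon
    have h1 : 4 ^ k ≤ 4 ^ Nat.log 4 (4 * T) := Nat.pow_le_pow_right (by norm_num) (by omega)
    exact hk.2 (h1.trans (Nat.pow_log_le_self 4 (by omega)))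
  have hpos : (0 : ℝ) < (2 : ℝ) ^ (Nat.log 4 (4 * T) + 1) := by positivity
  have hsqT : (0 : ℝ) < Real.sqrt (T : ℝ) := Real.sqrt_pos.mpr (by exact_mod_cast hT)
  calc ∑ k ∈ (Finset.range (T + 2)).filter (fun k => ¬4 ^ k ≤ 4 * T), 1 / (2 : ℝ) ^ k
      ≤ ∑ k ∈ Finset.Ico (Nat.log 4 (4 * T) + 1) (T + 2), 1 / (2 : ℝ) ^ k :=
        sum_le_sum_of_subset_of_nonneg hsub fun _ _ _ => by positivity
    _ = ∑ k ∈ Finset.Ico (Nat.log 4 (4 * T) + 1) (T + 2), (1 / 2 : ℝ) ^ k := by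
        simp only [one_div_pow]
    _ ≤ (1 / 2 : ℝ) ^ (Nat.log 4 (4 * T) + 1) / (1 - 1 / 2) :=
        geom_sum_Ico_le_of_lt_one (by norm_num) (by norm_num)
    _ = 2 / (2 : ℝ) ^ (Nat.log 4 (4 * T) + 1) := by rw [one_div_pow]; field_simp; ring
    _ ≤ 1 / Real.sqrt (T : ℝ) := by
        rw [div_le_div_iff₀ hpos hsqT, one_mul]
        have hsq : Real.sqrt (T : ℝ) * Real.sqrt (T : ℝ) = T :=
          Real.mul_self_sqrt (Nat.cast_nonneg T)
        have h4T' : (4 : ℝ) * T <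
            (2 : ℝ) ^ (Nat.log 4 (4 * T) + 1) * (2 : ℝ) ^ (Nat.log 4 (4 * T) + 1) := by
          rw [← mul_pow]
          norm_num
          exact_mod_cast h4T
        nlinarith [Real.sqrt_nonneg (T : ℝ), hsq, h4T']

/-- The `min` trick for the small dyadic levels: if `a ≤ x P + (2x+1)² C E` and `a ≤ N C E'` with
`0 ≤ E' ≤ E` and `1 ≤ x`, then `a / x ≤ P + 3 C E √N` (use the first bound when `3x ≤ √N` and
the second one otherwise). [folklore] -/
theorem de_low_term_le {x a N C E E' P : ℝ} (hx : 1 ≤ x) (hN : 0 ≤ N) (hC : 0 ≤ C)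
    (hE' : 0 ≤ E') (hEE : E' ≤ E) (hP : 0 ≤ P) (h1 : a ≤ x * P + (2 * x + 1) ^ 2 * C * E)
    (h2 : a ≤ N * C * E') : 1 / x * a ≤ P + 3 * C * E * Real.sqrt N := by
  have hx0 : 0 < x := one_pos.trans_le hx
  have hE : 0 ≤ E := hE'.trans hEE
  have s0 := Real.sqrt_nonneg N
  rw [one_div, inv_mul_le_iff₀ hx0]
  rcases le_or_gt (3 * x) (Real.sqrt N) with h | h
  · have h9 : (2 * x + 1) ^ 2 ≤ (3 * x) * (3 * x) := by nlinarith
    have k1 := mul_le_mul_of_nonneg_right (mul_le_mul_of_nonneg_right h9 hC) hE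
    have k2 := mul_le_mul_of_nonneg_right (mul_le_mul_of_nonneg_right
      (mul_le_mul_of_nonneg_left h (by linarith : (0 : ℝ) ≤ 3 * x)) hC) hE
    linarith
  · have k1 := mul_le_mul_of_nonneg_right (mul_le_mul_of_nonneg_right
      (mul_le_mul_of_nonneg_right h.le s0) hC) hE'
    rw [Real.mul_self_sqrt hN] at k1
    have k2 : 3 * x * Real.sqrt N * C * E' ≤ 3 * x * Real.sqrt N * C * E :=
      mul_le_mul_of_nonneg_left hEE (by positivity)
    have k3 : 0 ≤ x * P := mul_nonneg hx0.le hP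
    linarith

/-- **Dyadic sum of the short-vector counts.**  If `A k ≤ Dτ³ (4 NQ 2^k NC Dτ^{4d+1} +
(2·2^k+1)² NC² Dτ^d)` at the levels `4^k ≤ 4T` and `A k ≤ NQ NC² Dτ³` at every level, with
`NQ ≤ T < 2^{Dτ}`, then `Σ_{k < T+2} 2^{-k} A k ≤ 8 NQ NC Dτ^{4d+5} + 7 NC² Dτ^{d+4} √NQ`
(at most `Dτ + 1` small levels, each `≤ 4 NQ NC Dτ^{4d+4} + 3 NC² Dτ^{d+3} √NQ` by
`de_low_term_le`; the large levels contribute `≤ NQ NC² Dτ³ / √T ≤ NC² Dτ³ √NQ` by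
`de_sum_inv_two_pow_high_le`). [folklore] -/
theorem de_dyadic_sum_le (T Dτ d NQ sY sZ : ℕ) (A : ℕ → ℕ) (hT : 0 < T) (hD1 : 1 ≤ Dτ)
    (hTD : T < 2 ^ Dτ) (hNQ : NQ ≤ T)
    (hlow : ∀ k, 4 ^ k ≤ 4 * T → A k ≤ Dτ ^ 3 * (4 * NQ * 2 ^ k * (sY * sZ) * Dτ ^ (4 * d + 1) +
      (2 * 2 ^ k + 1) ^ 2 * sY ^ 2 * sZ ^ 2 * Dτ ^ d))
    (hall : ∀ k, A k ≤ NQ * (sY * sZ) ^ 2 * Dτ ^ 3) :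
    ∑ k ∈ Finset.range (T + 2), 1 / (2 : ℝ) ^ k * (A k : ℝ) ≤
      8 * (NQ : ℝ) * ((sY : ℝ) * (sZ : ℝ)) * (Dτ : ℝ) ^ (4 * d + 5) +
        7 * ((sY : ℝ) * (sZ : ℝ)) ^ 2 * (Dτ : ℝ) ^ (d + 4) * Real.sqrt (NQ : ℝ) := by
  have hD1' : (1 : ℝ) ≤ Dτ := by exact_mod_cast hD1
  have hNQ0 : (0 : ℝ) ≤ NQ := Nat.cast_nonneg _
  have h34 : (Dτ : ℝ) ^ 3 ≤ (Dτ : ℝ) ^ (d + 3) := pow_le_pow_right₀ hD1' (by omega)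
  have h3d4 : (Dτ : ℝ) ^ 3 ≤ (Dτ : ℝ) ^ (d + 4) := pow_le_pow_right₀ hD1' (by omega)
  have hall' : ∀ k, (A k : ℝ) ≤ NQ * ((sY : ℝ) * (sZ : ℝ)) ^ 2 * (Dτ : ℝ) ^ 3 := fun k => by
    exact_mod_cast hall k
  have hcnt : ((Finset.range (T + 2)).filter (fun k => 4 ^ k ≤ 4 * T)).card ≤ Dτ + 1 := by
    refine (card_le_card fun k hk => mem_range.mpr ?_).trans_eq (card_range _)
    by_contra hcon
    have h1 : 4 ^ (Dτ + 1) ≤ 4 ^ k := Nat.pow_le_pow_right (by norm_num) (by omega)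
    have h2 : 2 ^ Dτ ≤ 4 ^ Dτ := Nat.pow_le_pow_left (by norm_num) Dτ
    have h3 : 4 ^ (Dτ + 1) = 4 * 4 ^ Dτ := pow_succ' 4 Dτ
    have h4 : 4 ^ k ≤ 4 * T := (mem_filter.mp hk).2
    omega
  have hlow' : ∀ k ∈ (Finset.range (T + 2)).filter (fun k => 4 ^ k ≤ 4 * T),
      1 / (2 : ℝ) ^ k * (A k : ℝ) ≤ 4 * (NQ : ℝ) * ((sY : ℝ) * (sZ : ℝ)) * (Dτ : ℝ) ^ (4 * d + 4) +
        3 * ((sY : ℝ) * (sZ : ℝ)) ^ 2 * (Dτ : ℝ) ^ (d + 3) * Real.sqrt (NQ : ℝ) := by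
    intro k hk
    have h1 : (A k : ℝ) ≤ (Dτ : ℝ) ^ 3 * (4 * NQ * (2 : ℝ) ^ k * ((sY : ℝ) * (sZ : ℝ)) *
        (Dτ : ℝ) ^ (4 * d + 1) + (2 * (2 : ℝ) ^ k + 1) ^ 2 * (sY : ℝ) ^ 2 * (sZ : ℝ) ^ 2 *
          (Dτ : ℝ) ^ d) := by exact_mod_cast hlow k (mem_filter.mp hk).2
    exact de_low_term_le (one_le_pow₀ (by norm_num)) hNQ0 (sq_nonneg ((sY : ℝ) * (sZ : ℝ)))
      (by positivity) h34 (by positivity) (h1.trans_eq (by ring)) ((hall' k).trans_eq (by ring))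
  have hL : ∑ k ∈ (Finset.range (T + 2)).filter (fun k => 4 ^ k ≤ 4 * T),
      1 / (2 : ℝ) ^ k * (A k : ℝ) ≤
      ((Dτ : ℝ) + 1) * (4 * (NQ : ℝ) * ((sY : ℝ) * (sZ : ℝ)) * (Dτ : ℝ) ^ (4 * d + 4) +
        3 * ((sY : ℝ) * (sZ : ℝ)) ^ 2 * (Dτ : ℝ) ^ (d + 3) * Real.sqrt (NQ : ℝ)) := by
    refine (Finset.sum_le_sum hlow').trans ?_
    rw [sum_const, nsmul_eq_mul]
    exact mul_le_mul_of_nonneg_right (by exact_mod_cast hcnt) (by positivity)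
  have hH : ∑ k ∈ (Finset.range (T + 2)).filter (fun k => ¬4 ^ k ≤ 4 * T),
      1 / (2 : ℝ) ^ k * (A k : ℝ) ≤
      (NQ : ℝ) * ((sY : ℝ) * (sZ : ℝ)) ^ 2 * (Dτ : ℝ) ^ 3 * (1 / Real.sqrt (T : ℝ)) := by
    calc _ ≤ ∑ k ∈ (Finset.range (T + 2)).filter (fun k => ¬4 ^ k ≤ 4 * T),
          (NQ : ℝ) * ((sY : ℝ) * (sZ : ℝ)) ^ 2 * (Dτ : ℝ) ^ 3 * (1 / (2 : ℝ) ^ k) :=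
          Finset.sum_le_sum fun k _ => by
            rw [mul_comm]; exact mul_le_mul_of_nonneg_right (hall' k) (by positivity)
      _ ≤ _ := by
          rw [← mul_sum]
          exact mul_le_mul_of_nonneg_left (de_sum_inv_two_pow_high_le T hT) (by positivity)
  have hsqrt : (NQ : ℝ) * (1 / Real.sqrt (T : ℝ)) ≤ Real.sqrt (NQ : ℝ) := by
    have hsqT : (0 : ℝ) < Real.sqrt (T : ℝ) := Real.sqrt_pos.mpr (by exact_mod_cast hT)
    rw [mul_one_div, div_le_iff₀ hsqT]
    calc (NQ : ℝ) = Real.sqrt (NQ : ℝ) * Real.sqrt (NQ : ℝ) := (Real.mul_self_sqrt hNQ0).symm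
      _ ≤ Real.sqrt (NQ : ℝ) * Real.sqrt (T : ℝ) := mul_le_mul_of_nonneg_left
          (Real.sqrt_le_sqrt (by exact_mod_cast hNQ)) (Real.sqrt_nonneg _)
  have k1 : (NQ : ℝ) * ((sY : ℝ) * (sZ : ℝ)) ^ 2 * (Dτ : ℝ) ^ 3 * (1 / Real.sqrt (T : ℝ)) ≤
      ((sY : ℝ) * (sZ : ℝ)) ^ 2 * (Dτ : ℝ) ^ (d + 4) * Real.sqrt (NQ : ℝ) := by
    calc _ = ((sY : ℝ) * (sZ : ℝ)) ^ 2 * (Dτ : ℝ) ^ 3 * ((NQ : ℝ) * (1 / Real.sqrt (T : ℝ))) := by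
          ring
      _ ≤ ((sY : ℝ) * (sZ : ℝ)) ^ 2 * (Dτ : ℝ) ^ (d + 4) * Real.sqrt (NQ : ℝ) :=
          mul_le_mul (mul_le_mul_of_nonneg_left h3d4 (sq_nonneg _)) hsqrt (by positivity)
            (by positivity)
  have k2 : ((Dτ : ℝ) + 1) * (4 * (NQ : ℝ) * ((sY : ℝ) * (sZ : ℝ)) * (Dτ : ℝ) ^ (4 * d + 4) +
      3 * ((sY : ℝ) * (sZ : ℝ)) ^ 2 * (Dτ : ℝ) ^ (d + 3) * Real.sqrt (NQ : ℝ)) ≤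
      (2 * (Dτ : ℝ)) * (4 * (NQ : ℝ) * ((sY : ℝ) * (sZ : ℝ)) * (Dτ : ℝ) ^ (4 * d + 4) +
      3 * ((sY : ℝ) * (sZ : ℝ)) ^ 2 * (Dτ : ℝ) ^ (d + 3) * Real.sqrt (NQ : ℝ)) :=
    mul_le_mul_of_nonneg_right (by linarith) (by positivity)
  rw [← Finset.sum_filter_add_sum_filter_not (Finset.range (T + 2)) (fun k => 4 ^ k ≤ 4 * T)]
  refine ((add_le_add hL hH).trans (add_le_add k2 k1)).trans (le_of_eq ?_)
  ring

/-- **Final assembly of the constants.**  From `Σ R ≤ Dτ² Σ_Φ L`, the dyadic bound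
`Σ_Φ L ≤ #Φ (20 S²/q_min + 5) + 8 S B`, `#Φ ≤ NQ NC² Dτ³` and
`B ≤ 8 NQ NC Dτ^{4d+5} + 7 NC² Dτ^{d+4} √NQ` one gets
`Σ R ≤ 100 Dτ^{4d+7} (NQ NC² S²/q_min + NQ NC² + S NQ NC + S NC² √NQ)` (`Dτ ≥ 1`). [folklore] -/
theorem de_energy_assemble {ι κ : Type*} {Rs : Finset κ} {g : κ → ℕ} {Φ : Finset ι}
    {Lc : ι → ℕ} {Dτ d NQ S qmin sY sZ : ℕ} {B : ℝ}
    (hE : ∑ r ∈ Rs, g r ≤ Dτ ^ 2 * ∑ φ ∈ Φ, Lc φ)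
    (hL : ∑ φ ∈ Φ, (Lc φ : ℝ) ≤ (Φ.card : ℝ) * (20 * (S : ℝ) ^ 2 / qmin + 5) + 8 * (S : ℝ) * B)
    (hΦ : Φ.card ≤ NQ * (sY * sZ) ^ 2 * Dτ ^ 3)
    (hB : B ≤ 8 * (NQ : ℝ) * ((sY : ℝ) * (sZ : ℝ)) * (Dτ : ℝ) ^ (4 * d + 5) +
      7 * ((sY : ℝ) * (sZ : ℝ)) ^ 2 * (Dτ : ℝ) ^ (d + 4) * Real.sqrt (NQ : ℝ))
    (hD : 1 ≤ Dτ) :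
    ∑ r ∈ Rs, (g r : ℝ) ≤ 100 * (Dτ : ℝ) ^ (4 * d + 7) *
      ((NQ : ℝ) * ((sY : ℝ) * (sZ : ℝ)) ^ 2 * (S : ℝ) ^ 2 / (qmin : ℝ) +
        (NQ : ℝ) * ((sY : ℝ) * (sZ : ℝ)) ^ 2 + (S : ℝ) * (NQ : ℝ) * ((sY : ℝ) * (sZ : ℝ)) +
          (S : ℝ) * ((sY : ℝ) * (sZ : ℝ)) ^ 2 * Real.sqrt (NQ : ℝ)) := by
  have hD' : (1 : ℝ) ≤ Dτ := by exact_mod_cast hD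
  have hΦ' : (Φ.card : ℝ) ≤ (NQ : ℝ) * ((sY : ℝ) * (sZ : ℝ)) ^ 2 * (Dτ : ℝ) ^ 3 := by
    exact_mod_cast hΦ
  have hp5 : (Dτ : ℝ) ^ 5 ≤ (Dτ : ℝ) ^ (4 * d + 7) := pow_le_pow_right₀ hD' (by omega)
  have hp6 : (Dτ : ℝ) ^ (d + 6) ≤ (Dτ : ℝ) ^ (4 * d + 7) := pow_le_pow_right₀ hD' (by omega)
  have hP : (0 : ℝ) ≤ (Dτ : ℝ) ^ (4 * d + 7) := by positivity
  have c20 : 20 * (Dτ : ℝ) ^ 5 ≤ 100 * (Dτ : ℝ) ^ (4 * d + 7) :=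
    mul_le_mul (by norm_num) hp5 (by positivity) (by norm_num)
  have c64 : 64 * (Dτ : ℝ) ^ (4 * d + 7) ≤ 100 * (Dτ : ℝ) ^ (4 * d + 7) :=
    mul_le_mul_of_nonneg_right (by norm_num) hP
  have c56 : 56 * (Dτ : ℝ) ^ (d + 6) ≤ 100 * (Dτ : ℝ) ^ (4 * d + 7) :=
    mul_le_mul (by norm_num) hp6 (by positivity) (by norm_num)
  calc ∑ r ∈ Rs, (g r : ℝ) ≤ (Dτ : ℝ) ^ 2 * ∑ φ ∈ Φ, (Lc φ : ℝ) := by exact_mod_cast hE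
    _ ≤ (Dτ : ℝ) ^ 2 * ((Φ.card : ℝ) * (20 * (S : ℝ) ^ 2 / qmin + 5) + 8 * (S : ℝ) * B) :=
        mul_le_mul_of_nonneg_left hL (by positivity)
    _ ≤ (Dτ : ℝ) ^ 2 * ((NQ : ℝ) * ((sY : ℝ) * (sZ : ℝ)) ^ 2 * (Dτ : ℝ) ^ 3 *
          (20 * (S : ℝ) ^ 2 / qmin + 5) + 8 * (S : ℝ) *
          (8 * (NQ : ℝ) * ((sY : ℝ) * (sZ : ℝ)) * (Dτ : ℝ) ^ (4 * d + 5) +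
            7 * ((sY : ℝ) * (sZ : ℝ)) ^ 2 * (Dτ : ℝ) ^ (d + 4) * Real.sqrt (NQ : ℝ))) :=
        mul_le_mul_of_nonneg_left (add_le_add (mul_le_mul_of_nonneg_right hΦ' (by positivity))
          (mul_le_mul_of_nonneg_left hB (by positivity))) (by positivity)
    _ = 20 * (Dτ : ℝ) ^ 5 * ((NQ : ℝ) * ((sY : ℝ) * (sZ : ℝ)) ^ 2 * (S : ℝ) ^ 2 / (qmin : ℝ)) +
          5 * (Dτ : ℝ) ^ 5 * ((NQ : ℝ) * ((sY : ℝ) * (sZ : ℝ)) ^ 2) +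
          64 * (Dτ : ℝ) ^ (4 * d + 7) * ((S : ℝ) * (NQ : ℝ) * ((sY : ℝ) * (sZ : ℝ))) +
          56 * (Dτ : ℝ) ^ (d + 6) * ((S : ℝ) * ((sY : ℝ) * (sZ : ℝ)) ^ 2 * Real.sqrt (NQ : ℝ)) := by
        ring
    _ ≤ 100 * (Dτ : ℝ) ^ (4 * d + 7) * ((NQ : ℝ) * ((sY : ℝ) * (sZ : ℝ)) ^ 2 * (S : ℝ) ^ 2 / qmin) +
          100 * (Dτ : ℝ) ^ (4 * d + 7) * ((NQ : ℝ) * ((sY : ℝ) * (sZ : ℝ)) ^ 2) +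
          100 * (Dτ : ℝ) ^ (4 * d + 7) * ((S : ℝ) * (NQ : ℝ) * ((sY : ℝ) * (sZ : ℝ))) +
          100 * (Dτ : ℝ) ^ (4 * d + 7) * ((S : ℝ) * ((sY : ℝ) * (sZ : ℝ)) ^ 2 * Real.sqrt NQ) :=
        add_le_add (add_le_add (add_le_add (mul_le_mul_of_nonneg_right c20 (by positivity))
          (mul_le_mul_of_nonneg_right (c20.trans' (mul_le_mul_of_nonneg_right (by norm_num)
            (by positivity))) (by positivity)))
          (mul_le_mul_of_nonneg_right c64 (by positivity)))
          (mul_le_mul_of_nonneg_right c56 (by positivity))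
    _ = _ := by ring

/-- `4 Y_{i₁} Z_{i₁} ≤ T` when `c₂ V(2Y) ≤ T` and `c₃ V(2Z) ≤ T` (`cᵢ ≥ 1`): the coordinate `i₁` of
value `1` enters `V(2Y)` through the factor `(2 Y_{i₁})²`, so `4 Y_{i₁}² ≤ T`, likewise
`4 Z_{i₁}² ≤ T`. [folklore] -/
theorem de_four_mul_le {d : ℕ} (i₁ : Fin d) (h1 : (i₁ : ℕ) = 1) {c₂ c₃ : ℕ} (hc₂ : 0 < c₂)
    (hc₃ : 0 < c₃) (Y Z : Fin d → ℕ) (hY : ∀ j, 0 < Y j) (hZ : ∀ j, 0 < Z j) {T : ℕ}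
    (hTY : c₂ * shapeVal (fun j => 2 * Y j) ≤ T) (hTZ : c₃ * shapeVal (fun j => 2 * Z j) ≤ T) :
    4 * (Y i₁ * Z i₁) ≤ T := by
  have key : ∀ {c : ℕ} {W : Fin d → ℕ}, 0 < c → (∀ j, 0 < W j) →
      c * shapeVal (fun j => 2 * W j) ≤ T → (2 * W i₁) * (2 * W i₁) ≤ T := by
    intro c W hc hW hT
    have hpos : 0 < shapeVal (fun j => 2 * W j) :=
      prod_pos fun i _ => pow_pos (Nat.mul_pos two_pos (hW i)) _
    have hdvd : (2 * W i₁) ^ ((i₁ : ℕ) + 1) ∣ shapeVal (fun j => 2 * W j) :=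
      dvd_prod_of_mem (fun i => (2 * W i) ^ ((i : ℕ) + 1)) (mem_univ i₁)
    calc (2 * W i₁) * (2 * W i₁) = (2 * W i₁) ^ ((i₁ : ℕ) + 1) := by rw [h1, pow_succ, pow_one]
      _ ≤ shapeVal (fun j => 2 * W j) := Nat.le_of_dvd hpos hdvd
      _ ≤ c * shapeVal (fun j => 2 * W j) := Nat.le_mul_of_pos_left _ hc
      _ ≤ T := hT
  rcases le_total (Y i₁) (Z i₁) with h | h
  · calc 4 * (Y i₁ * Z i₁) ≤ 4 * (Z i₁ * Z i₁) := Nat.mul_le_mul_left 4 (Nat.mul_le_mul_right _ h)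
      _ = (2 * Z i₁) * (2 * Z i₁) := by ring
      _ ≤ T := key hc₃ hZ hTZ
  · calc 4 * (Y i₁ * Z i₁) ≤ 4 * (Y i₁ * Y i₁) := Nat.mul_le_mul_left 4 (Nat.mul_le_mul_left _ h)
      _ = (2 * Y i₁) * (2 * Y i₁) := by ring
      _ ≤ T := key hc₂ hY hTY

/-- For a host tuple `r ∈ subBox Qᶜ X`: `W_Q(X) ≤ W_Q(r)` (coordinatewise `X ≤ r`). [folklore] -/
theorem de_onVal_corner_le {d : ℕ} {Q : Finset (Fin d)} {X r : Fin d → ℕ}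
    (hr : r ∈ subBox Qᶜ X) : onVal Q X ≤ onVal Q r := by
  rw [mem_subBox] at hr
  refine onVal_mono Q fun i => ?_
  by_cases hi : i ∈ Qᶜ
  · exact ((hr i).1 hi).ge
  · exact ((hr i).2 hi).1

/-- `W_Q(x) ≤ V(x)` for a positive tuple `x` (`V = offVal_Q · W_Q` with `offVal_Q ≥ 1`).
[folklore] -/
theorem de_onVal_le_shapeVal {d : ℕ} (Q : Finset (Fin d)) {x : Fin d → ℕ} (hx : ∀ j, 0 < x j) :
    onVal Q x ≤ shapeVal x := by
  rw [shapeVal_eq_offVal_mul_onVal Q x]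
  exact Nat.le_mul_of_pos_left _ (prod_pos fun i _ => pow_pos (hx i) _)

/-- `#subBox Qᶜ X ≤ W_Q(X)`: the free coordinates of the host sub-box are those in `Q`, and
`∏_{i∈Q} Xᵢ ≤ ∏_{i∈Q} Xᵢ^{i+1}`. [folklore] -/
theorem de_card_subBox_compl_le_onVal {d : ℕ} (Q : Finset (Fin d)) (X : Fin d → ℕ) :
    (subBox Qᶜ X).card ≤ onVal Q X := by
  rw [card_subBox, compl_compl]
  exact prod_le_prod (fun i _ => Nat.zero_le _) fun i _ => Nat.le_self_pow (Nat.succ_ne_zero _) _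

/-- If `τ(m) ≤ Dτ` for `0 < m ≤ 8T³` and `T ≥ 1` then `T < 2^{Dτ}`: with `2^j ≤ T < 2^{j+1}` one
has `τ(2^j) = j + 1 ≤ Dτ`. [folklore] -/
theorem de_lt_two_pow_of_divisors_le {T Dτ : ℕ} (hT : 0 < T)
    (hD : ∀ m : ℕ, m ≠ 0 → m ≤ 8 * T ^ 3 → m.divisors.card ≤ Dτ) : T < 2 ^ Dτ := by
  have h2j : 2 ^ Nat.log 2 T ≤ T := Nat.pow_log_le_self 2 hT.ne'
  have hT3 : T ≤ 8 * T ^ 3 :=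
    (Nat.le_self_pow (by norm_num) T).trans (Nat.le_mul_of_pos_left _ (by norm_num))
  have hτ := hD (2 ^ Nat.log 2 T) (pow_ne_zero _ two_ne_zero) (h2j.trans hT3)
  rw [Nat.divisors_prime_pow Nat.prime_two, card_map, card_range] at hτ
  calc T < 2 ^ (Nat.log 2 T + 1) := Nat.lt_pow_succ_log_self one_lt_two T
    _ ≤ 2 ^ Dτ := Nat.pow_le_pow_right two_pos hτ

/-- **Steps 1–2 of the assembly** (in `ℕ`): summing `de_energy_le_productVars` and
`de_productVars_card_le_sum_coprime` over the host tuples `r ∈ subBox Qᶜ X` (modulus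
`q(r) = W_Q(r)`, `0 < q(r) ≤ W_Q(2X)`) and reindexing the resulting triple sum by the fibre set
`ΦL` of `de_card_fibres_le` (`de_sum_sum_sum_eq_sum_fibres`):
`Σ_r #R_{q(r)} ≤ Dτ² Σ_{φ ∈ ΦL} #{(A, B) ∈ [1, S]² : q(φ) ∣ A - l(φ) B}`, `S = 4 Y_{i₁} Z_{i₁}`.
[folklore] -/
theorem de_energy_sum_nat_le {d : ℕ} (i₀ i₁ : Fin d) (h0 : (i₀ : ℕ) = 0) (h1 : (i₁ : ℕ) = 1) {c₂ c₃ : ℕ} (hc₂ : 0 < c₂) (hc₃ : 0 < c₃) (X Y Z : Fin d → ℕ) (hX : ∀ j, 0 < X j) (hY : ∀ j, 0 < Y j) (hZ : ∀ j, 0 < Z j) {T Dτ : ℕ} (hST : 4 * (Y i₁ * Z i₁) ≤ T) (hD : ∀ m : ℕ, m ≠ 0 → m ≤ T → m.divisors.card ≤ Dτ) (Q : Finset (Fin d)) : ∑ r ∈ subBox Qᶜ X, (((subBox {i₀} Y ×ˢ subBox {i₀} Z) ×ˢ (subBox {i₀} Y ×ˢ subBox {i₀} Z)).filter (fun p : ((Fin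 d → ℕ) × (Fin d → ℕ)) × ((Fin d → ℕ) × (Fin d → ℕ)) => Nat.Coprime (onVal Q r) (c₂ * offVal {i₀} p.1.1) ∧ Nat.Coprime (onVal Q r) (c₃ * offVal {i₀} p.1.2) ∧ Nat.Coprime (onVal Q r) (c₂ * offVal {i₀} p.2.1) ∧ Nat.Coprime (onVal Q r) (c₃ * offVal {i₀} p.2.2) ∧ ((onVal Q r) : ℤ) ∣ ((c₂ * offVal {i₀} p.2.1 * (c₃ * offVal {i₀} p.1.2) : ℕ) : ℤ) - ((c₂ * offVal {i₀} p.1.1 * (c₃ * offVal {i₀} p.2.2) : ℕ) : ℤ))).card ≤ Dτ ^ 2 * ∑ φ ∈ (((subBox Qᶜ X ×ˢ ((subBox ({i₀, i₁} : Finset (Fin d)) Y ×ˢ subBox ({i₀, i₁} : Finset (Fin d)) Z) ×ˢ (subBox ({i₀, i₁} : Finset (Fin d)) Y ×ˢ subBox ({i₀, i₁} : Finset (Fin d)) Z))) ×ˢ Finset.range (onVal Q (fun j => 2 * X j))).filter (fun φ : ((Fin d → ℕ) × (((Fin d → ℕ) × (Fin d → ℕ)) × ((Fin d → ℕ) ×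 (Fin d → ℕ)))) × ℕ => φ.2 < onVal Q φ.1.1 ∧ Nat.Coprime (onVal Q φ.1.1) (c₂ * offVal ({i₀, i₁} : Finset (Fin d)) φ.1.2.1.1 * (c₃ * offVal ({i₀, i₁} : Finset (Fin d)) φ.1.2.1.2)) ∧ Nat.Coprime (onVal Q φ.1.1) (c₂ * offVal ({i₀, i₁} : Finset (Fin d)) φ.1.2.2.1 * (c₃ * offVal ({i₀, i₁} : Finset (Fin d)) φ.1.2.2.2)) ∧ ((onVal Q φ.1.1 : ℕ) : ℤ) ∣ ((φ.2 ^ 2 * (c₂ * offVal ({i₀, i₁} : Finset (Fin d)) φ.1.2.1.1 * (c₃ * offVal ({i₀, i₁} : Finset (Fin d)) φ.1.2.1.2)) : ℕ) : ℤ) - (((c₂ * offVal ({i₀, i₁} : Finset (Fin d)) φ.1.2.2.1 * (c₃ * offVal ({i₀, i₁} : Finset (Fin d)) φ.1.2.2.2)) : ℕ) : ℤ))), ((Finset.Icc (1 : ℤ) ((4 * (Y i₁ * Z i₁) : ℕ) : ℤ) ×ˢ Finset.Icc (1 : ℤ) ((4 * (Y i₁ * Z i₁) : ℕ) : ℤ)).filter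 (fun p : ℤ × ℤ => ((onVal Q φ.1.1 : ℕ) : ℤ) ∣ p.1 - ((φ.2 : ℕ) : ℤ) * p.2)).card := by
  have hc : (4 : ℤ) * ((Y i₁ : ℤ) * (Z i₁ : ℤ)) = ((4 * (Y i₁ * Z i₁) : ℕ) : ℤ) := by
    push_cast; ring
  refine (Finset.sum_le_sum fun r hr =>
    (de_energy_le_productVars i₀ i₁ h0 h1 (onVal Q r) c₂ c₃
      (Nat.pos_of_ne_zero (de_onVal_ne_zero_and_le hX hr).1) hc₂ hc₃ Y Z hY hZ hST hD).trans
    (Nat.mul_le_mul_left _ (de_productVars_card_le_sum_coprime i₀ i₁ (onVal Q r) c₂ c₃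
      (Nat.pos_of_ne_zero (de_onVal_ne_zero_and_le hX hr).1) Y Z))).trans ?_
  rw [← Finset.mul_sum]
  refine Nat.mul_le_mul_left _ (le_of_eq ?_)
  rw [hc]
  exact de_sum_sum_sum_eq_sum_fibres (subBox Qᶜ X) _ (onVal Q) (onVal Q (fun j => 2 * X j))
    (fun r hr => (de_onVal_ne_zero_and_le hX hr).2) _ _ _ _

/-- **Multiplicative-energy bound of the DE tool** (registered stub `de_energy_sum_le`, line
`critical-kloosterman-powerful-moduli` of crux stmt-ABC-2757).  With host box `X`, level set `Q`
(host tuples `r ∈ subBox Qᶜ X`, modulus `q(r) = W_Q(r)`, `q_min = W_Q(X)`), side boxes `Y, Z`,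
`NQ = #subBox Qᶜ X`, `NC = #subBox{i₀,i₁} Y · #subBox{i₀,i₁} Z`, `S = 4 Y_{i₁} Z_{i₁}`:
`Σ_r #R_{q(r)} ≤ 100 Dτ^{4d+7} (NQ NC² S²/q_min + NQ NC² + S NQ NC + S NC² √NQ)`, where `R_q` is
the mixed multiplicative energy `#{m(r₂') n(r₃) ≡ m(r₂) n(r₃') (mod q), units}`.
Proof: `de_energy_sum_nat_le` (product variables, root lattices, fibre set `ΦL`), the dyadic
lattice-point bound `de_sum_latticeCount_dyadic_le` (`q_min ≤ q(φ) ≤ T ≤ 2^T`), the level counts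
`de_card_short_le` + (`de_card_exact_le`, `de_card_inexact_le`) for `4^k ≤ 4T` and
`de_card_fibres_le` for all `k` summed by `de_dyadic_sum_le`, and the bookkeeping
`de_energy_assemble`. [folklore] -/
theorem de_energy_sum_le : ∀ {d : ℕ} (i₀ i₁ : Fin d), (i₀ : ℕ) = 0 → (i₁ : ℕ) = 1 → ∀ {c₂ c₃ : ℕ}, 0 < c₂ → 0 < c₃ → ∀ (X Y Z : Fin d → ℕ), (∀ j, 0 < X j) → (∀ j, 0 < Y j) → (∀ j, 0 < Z j) → ∀ {T Dτ : ℕ}, shapeVal (fun j => 2 * X j) ≤ T → c₂ * shapeVal (fun j => 2 * Y j) ≤ T → c₃ * shapeVal (fun j => 2 * Z j) ≤ T → (∀ m : ℕ, m ≠ 0 → m ≤ 8 * T ^ 3 → m.divisors.card ≤ Dτ) → ∀ (Q : Finset (Fin d)), (∑ r ∈ subBox Qᶜ X, (((((subBox {i₀} Y ×ˢ subBox {i₀} Z) ×ˢ (subBox {i₀} Y ×ˢ subBox {i₀} Z)).filter (fun p : ((Fin d → ℕ) × (Fin d → ℕ)) × ((Fin d → ℕ) × (Fin d → ℕ)) =>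 Nat.Coprime (onVal Q r) (c₂ * offVal {i₀} p.1.1) ∧ Nat.Coprime (onVal Q r) (c₃ * offVal {i₀} p.1.2) ∧ Nat.Coprime (onVal Q r) (c₂ * offVal {i₀} p.2.1) ∧ Nat.Coprime (onVal Q r) (c₃ * offVal {i₀} p.2.2) ∧ ((onVal Q r) : ℤ) ∣ ((c₂ * offVal {i₀} p.2.1 * (c₃ * offVal {i₀} p.1.2) : ℕ) : ℤ) - ((c₂ * offVal {i₀} p.1.1 * (c₃ * offVal {i₀} p.2.2) : ℕ) : ℤ)))).card : ℝ)) ≤ 100 * (Dτ : ℝ) ^ (4 * d + 7) * (((subBox Qᶜ X).card : ℝ) * (((subBox ({i₀, i₁} : Finset (Fin d)) Y).card : ℝ) * ((subBox ({i₀, i₁} : Finset (Fin d)) Z).card : ℝ)) ^ 2 * (4 * ((Y i₁ : ℝ) * Z i₁)) ^ 2 / ((onVal Q X : ℕ) : ℝ) + ((subBox Qᶜ X).card : ℝ) * (((subBox ({i₀, i₁} : Finset (Fin d)) Y).card : ℝ) * ((subBox ({i₀, i₁} : Finset (Fin d)) Z).card : ℝ)) ^ 2 + (4 * ((Y i₁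 : ℝ) * Z i₁)) * ((subBox Qᶜ X).card : ℝ) * (((subBox ({i₀, i₁} : Finset (Fin d)) Y).card : ℝ) * ((subBox ({i₀, i₁} : Finset (Fin d)) Z).card : ℝ)) + (4 * ((Y i₁ : ℝ) * Z i₁)) * (((subBox ({i₀, i₁} : Finset (Fin d)) Y).card : ℝ) * ((subBox ({i₀, i₁} : Finset (Fin d)) Z).card : ℝ)) ^ 2 * Real.sqrt ((subBox Qᶜ X).card : ℝ)) := by
  intro d i₀ i₁ h0 h1 c₂ c₃ hc₂ hc₃ X Y Z hX hY hZ T Dτ hTX hTY hTZ hD Q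
  have hT0 : 0 < T := lt_of_lt_of_le
    (Nat.mul_pos hc₂ (prod_pos fun i _ => pow_pos (Nat.mul_pos two_pos (hY i)) _)) hTY
  have hT3 : T ≤ 8 * T ^ 3 :=
    (Nat.le_self_pow (by norm_num) T).trans (Nat.le_mul_of_pos_left _ (by norm_num))
  have hD' : ∀ m : ℕ, m ≠ 0 → m ≤ T → m.divisors.card ≤ Dτ := fun m hm hmT =>
    hD m hm (hmT.trans hT3)
  have hTD : T < 2 ^ Dτ := de_lt_two_pow_of_divisors_le hT0 hD
  have hD1 : 1 ≤ Dτ := Nat.pos_of_ne_zero fun h => by rw [h, pow_zero] at hTD; omega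
  have hST : 4 * (Y i₁ * Z i₁) ≤ T := de_four_mul_le i₁ h1 hc₂ hc₃ Y Z hY hZ hTY hTZ
  have hqT : onVal Q (fun j => 2 * X j) ≤ T :=
    (de_onVal_le_shapeVal Q fun j => Nat.mul_pos two_pos (hX j)).trans hTX
  have hNQT : (subBox Qᶜ X).card ≤ T := (de_card_subBox_compl_le_onVal Q X).trans
    ((onVal_mono Q fun i => Nat.le_mul_of_pos_left (X i) two_pos).trans hqT)
  have h12 := de_energy_sum_nat_le i₀ i₁ h0 h1 hc₂ hc₃ X Y Z hX hY hZ hST hD' Q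
  have hS : (4 : ℝ) * ((Y i₁ : ℝ) * (Z i₁ : ℝ)) = ((4 * (Y i₁ * Z i₁) : ℕ) : ℝ) := by
    push_cast; ring
  rw [hS]
  -- the binder type of `φ` is spelled out: it pins the index type before unification
  refine de_energy_assemble h12
    (de_sum_latticeCount_dyadic_le _
      (fun φ : ((Fin d → ℕ) × (((Fin d → ℕ) × (Fin d → ℕ)) × ((Fin d → ℕ) × (Fin d → ℕ)))) × ℕ =>
        onVal Q φ.1.1)
      (fun φ : ((Fin d → ℕ) × (((Fin d → ℕ) × (Fin d → ℕ)) × ((Fin d → ℕ) × (Fin d → ℕ)))) × ℕ =>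
        ((φ.2 : ℕ) : ℤ))
      (4 * (Y i₁ * Z i₁)) (onVal Q X) T (prod_pos fun i _ => pow_pos (hX i) _)
      (fun φ hφ => ?_) (fun φ hφ => ?_))
    (de_card_fibres_le i₀ i₁ c₂ c₃ X Y Z Q hX hqT hD')
    (de_dyadic_sum_le T Dτ d (subBox Qᶜ X).card _ _ _ hT0 hD1 hTD hNQT ?_ ?_) hD1
  · exact de_onVal_corner_le (mem_product.mp (mem_product.mp (mem_filter.mp hφ).1).1).1
  · exact ((de_onVal_ne_zero_and_le hX
      (mem_product.mp (mem_product.mp (mem_filter.mp hφ).1).1).1).2.trans hqT).trans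
      Nat.lt_two_pow_self.le
  · intro k hk
    have hL : (2 ^ k) ^ 2 ≤ 4 * T := by
      rwa [← pow_mul, mul_comm, pow_mul, show (2 : ℕ) ^ 2 = 4 by norm_num]
    exact (de_card_short_le i₀ i₁ c₂ c₃ X Y Z Q k hX hqT hD').trans (Nat.mul_le_mul_left _
      ((de_card_filter_dvd_le_add _ _ _ _).trans (add_le_add
        (de_card_exact_le i₀ i₁ c₂ c₃ X Y Z Q (2 ^ k) hD hL hTY hTZ hY hZ hc₂ hc₃)
        (de_card_inexact_le i₀ i₁ c₂ c₃ X Y Z Q (2 ^ k) hD hL hTY hTZ hY hZ hc₂ hc₃))))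
  · exact fun k => (card_filter_le _ _).trans (de_card_fibres_le i₀ i₁ c₂ c₃ X Y Z Q hX hqT hD')

end Summit.ABC.ABC.Theorems.MazurKaneLaw
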